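import Summits.AtomisticToContinuum.Crystallization.Theorems.FrustratedLawDichotomyStrainedPatchHomLeafTableDataK3
import Summits.AtomisticToContinuum.Crystallization.Theorems.FrustratedLawDichotomyStrainedPatchHomLeafTableRowK
import Summits.AtomisticToContinuum.Crystallization.Theorems.FrustratedLawDichotomyStrainedPatchHomLeafTableTop

/-!
# v3 ("K") leaf checker — CERTIFICATION of the tier tables (kernel `decide`, chunk by chunk): tier 3 (ρ = 0.12): 649 rows

decomp-a2c hand-1 g22 (crux `AperiodicFrustratedLawGap`, stmt-AtomisticToContinuum-27623; critic rows 863/865 checker v3).  DEF-FREE.  Every chunk of ≤ 40 rows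
is ONE kernel evaluation of `QT.allOKK tabE 7` (≈ 0.22 s per row measured: value / derivative checks and the 8 curvature pieces of `Row.okK`); internal nodes are
assembled from their children's lemmas plus one row.  0 sorry; standard axioms.  `--supports stmt-AtomisticToContinuum-27623`.
-/

namespace Summit.AtomisticToContinuum.Crystallization.Theorems.FrustratedLawDichotomyStrainedPatchHomLeafTableCheck

/-- Rows 0–40 of tier 3 pass `Row.okK tabE 7`. [kernel computation] -/
theorem qk3_4_ok : QT.allOKK tabE 7 qk3_4 = true := by decide +kernel

/-- Rows 41–81 of tier 3 pass `Row.okK tabE 7`. [kernel computation] -/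
theorem qk3_5_ok : QT.allOKK tabE 7 qk3_5 = true := by decide +kernel

/-- Rows 0–81 of tier 3 pass `Row.okK tabE 7` (children + the node's row). [kernel computation] -/
theorem qk3_3_ok : QT.allOKK tabE 7 qk3_3 = true := by
  unfold qk3_3; simp only [QT.allOKK, qk3_4_ok, qk3_5_ok, Bool.true_and, Bool.and_true]; decide +kernel

/-- Rows 82–122 of tier 3 pass `Row.okK tabE 7`. [kernel computation] -/
theorem qk3_7_ok : QT.allOKK tabE 7 qk3_7 = true := by decide +kernel

/-- Rows 123–162 of tier 3 pass `Row.okK tabE 7`. [kernel computation] -/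
theorem qk3_8_ok : QT.allOKK tabE 7 qk3_8 = true := by decide +kernel

/-- Rows 82–162 of tier 3 pass `Row.okK tabE 7` (children + the node's row). [kernel computation] -/
theorem qk3_6_ok : QT.allOKK tabE 7 qk3_6 = true := by
  unfold qk3_6; simp only [QT.allOKK, qk3_7_ok, qk3_8_ok, Bool.true_and, Bool.and_true]; decide +kernel

/-- Rows 0–162 of tier 3 pass `Row.okK tabE 7` (children + the node's row). [kernel computation] -/
theorem qk3_2_ok : QT.allOKK tabE 7 qk3_2 = true := by
  unfold qk3_2; simp only [QT.allOKK, qk3_3_ok, qk3_6_ok, Bool.true_and, Bool.and_true]; decide +kernel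

/-- Rows 163–203 of tier 3 pass `Row.okK tabE 7`. [kernel computation] -/
theorem qk3_11_ok : QT.allOKK tabE 7 qk3_11 = true := by decide +kernel

/-- Rows 204–243 of tier 3 pass `Row.okK tabE 7`. [kernel computation] -/
theorem qk3_12_ok : QT.allOKK tabE 7 qk3_12 = true := by decide +kernel

/-- Rows 163–243 of tier 3 pass `Row.okK tabE 7` (children + the node's row). [kernel computation] -/
theorem qk3_10_ok : QT.allOKK tabE 7 qk3_10 = true := by
  unfold qk3_10; simp only [QT.allOKK, qk3_11_ok, qk3_12_ok, Bool.true_and, Bool.and_true]; decide +kernel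

/-- Rows 244–284 of tier 3 pass `Row.okK tabE 7`. [kernel computation] -/
theorem qk3_14_ok : QT.allOKK tabE 7 qk3_14 = true := by decide +kernel

/-- Rows 285–324 of tier 3 pass `Row.okK tabE 7`. [kernel computation] -/
theorem qk3_15_ok : QT.allOKK tabE 7 qk3_15 = true := by decide +kernel

/-- Rows 244–324 of tier 3 pass `Row.okK tabE 7` (children + the node's row). [kernel computation] -/
theorem qk3_13_ok : QT.allOKK tabE 7 qk3_13 = true := by
  unfold qk3_13; simp only [QT.allOKK, qk3_14_ok, qk3_15_ok, Bool.true_and, Bool.and_true]; decide +kernel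

/-- Rows 163–324 of tier 3 pass `Row.okK tabE 7` (children + the node's row). [kernel computation] -/
theorem qk3_9_ok : QT.allOKK tabE 7 qk3_9 = true := by
  unfold qk3_9; simp only [QT.allOKK, qk3_10_ok, qk3_13_ok, Bool.true_and, Bool.and_true]; decide +kernel

/-- Rows 0–324 of tier 3 pass `Row.okK tabE 7` (children + the node's row). [kernel computation] -/
theorem qk3_1_ok : QT.allOKK tabE 7 qk3_1 = true := by
  unfold qk3_1; simp only [QT.allOKK, qk3_2_ok, qk3_9_ok, Bool.true_and, Bool.and_true]; decide +kernel

/-- Rows 325–365 of tier 3 pass `Row.okK tabE 7`. [kernel computation] -/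
theorem qk3_19_ok : QT.allOKK tabE 7 qk3_19 = true := by decide +kernel

/-- Rows 366–406 of tier 3 pass `Row.okK tabE 7`. [kernel computation] -/
theorem qk3_20_ok : QT.allOKK tabE 7 qk3_20 = true := by decide +kernel

/-- Rows 325–406 of tier 3 pass `Row.okK tabE 7` (children + the node's row). [kernel computation] -/
theorem qk3_18_ok : QT.allOKK tabE 7 qk3_18 = true := by
  unfold qk3_18; simp only [QT.allOKK, qk3_19_ok, qk3_20_ok, Bool.true_and, Bool.and_true]; decide +kernel

/-- Rows 407–447 of tier 3 pass `Row.okK tabE 7`. [kernel computation] -/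
theorem qk3_22_ok : QT.allOKK tabE 7 qk3_22 = true := by decide +kernel

/-- Rows 448–487 of tier 3 pass `Row.okK tabE 7`. [kernel computation] -/
theorem qk3_23_ok : QT.allOKK tabE 7 qk3_23 = true := by decide +kernel

/-- Rows 407–487 of tier 3 pass `Row.okK tabE 7` (children + the node's row). [kernel computation] -/
theorem qk3_21_ok : QT.allOKK tabE 7 qk3_21 = true := by
  unfold qk3_21; simp only [QT.allOKK, qk3_22_ok, qk3_23_ok, Bool.true_and, Bool.and_true]; decide +kernel

/-- Rows 325–487 of tier 3 pass `Row.okK tabE 7` (children + the node's row). [kernel computation] -/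
theorem qk3_17_ok : QT.allOKK tabE 7 qk3_17 = true := by
  unfold qk3_17; simp only [QT.allOKK, qk3_18_ok, qk3_21_ok, Bool.true_and, Bool.and_true]; decide +kernel

/-- Rows 488–528 of tier 3 pass `Row.okK tabE 7`. [kernel computation] -/
theorem qk3_26_ok : QT.allOKK tabE 7 qk3_26 = true := by decide +kernel

/-- Rows 529–568 of tier 3 pass `Row.okK tabE 7`. [kernel computation] -/
theorem qk3_27_ok : QT.allOKK tabE 7 qk3_27 = true := by decide +kernel

/-- Rows 488–568 of tier 3 pass `Row.okK tabE 7` (children + the node's row). [kernel computation] -/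
theorem qk3_25_ok : QT.allOKK tabE 7 qk3_25 = true := by
  unfold qk3_25; simp only [QT.allOKK, qk3_26_ok, qk3_27_ok, Bool.true_and, Bool.and_true]; decide +kernel

/-- Rows 569–609 of tier 3 pass `Row.okK tabE 7`. [kernel computation] -/
theorem qk3_29_ok : QT.allOKK tabE 7 qk3_29 = true := by decide +kernel

/-- Rows 610–649 of tier 3 pass `Row.okK tabE 7`. [kernel computation] -/
theorem qk3_30_ok : QT.allOKK tabE 7 qk3_30 = true := by decide +kernel

/-- Rows 569–649 of tier 3 pass `Row.okK tabE 7` (children + the node's row). [kernel computation] -/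
theorem qk3_28_ok : QT.allOKK tabE 7 qk3_28 = true := by
  unfold qk3_28; simp only [QT.allOKK, qk3_29_ok, qk3_30_ok, Bool.true_and, Bool.and_true]; decide +kernel

/-- Rows 488–649 of tier 3 pass `Row.okK tabE 7` (children + the node's row). [kernel computation] -/
theorem qk3_24_ok : QT.allOKK tabE 7 qk3_24 = true := by
  unfold qk3_24; simp only [QT.allOKK, qk3_25_ok, qk3_28_ok, Bool.true_and, Bool.and_true]; decide +kernel

/-- Rows 325–649 of tier 3 pass `Row.okK tabE 7` (children + the node's row). [kernel computation] -/
theorem qk3_16_ok : QT.allOKK tabE 7 qk3_16 = true := by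
  unfold qk3_16; simp only [QT.allOKK, qk3_17_ok, qk3_24_ok, Bool.true_and, Bool.and_true]; decide +kernel

/-- Rows 0–649 of tier 3 pass `Row.okK tabE 7` (children + the node's row). [kernel computation] -/
theorem qk3_0_ok : QT.allOKK tabE 7 qk3_0 = true := by
  unfold qk3_0; simp only [QT.allOKK, qk3_1_ok, qk3_16_ok, Bool.true_and, Bool.and_true]; decide +kernel

/-- ★ Every row of the tier-3 table passes `Row.okK tabE 7`. [kernel computation] -/
theorem qTableK3_allOKK : QT.allOKK tabE 7 qTableK3 = true := qk3_0_ok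

end Summit.AtomisticToContinuum.Crystallization.Theorems.FrustratedLawDichotomyStrainedPatchHomLeafTableCheck
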